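import Literature.NumberTheory.EllipticCurves.ManinConstantConductorLe300000
import Literature.NumberTheory.EllipticCurves.Rank1Residual.Predicates
import Literature.NumberTheory.EllipticCurves.KuriharaNumberDeepInvariants
import HarnessLib

/-!
# Route `KimAtThreeKolyvagin` (rung W2), crux `ShallowEqDeepOffKatoStratum` (item 19599): the
# «`3 ∣` Manin constant» branch of `stub_additiveDefect` is EMPTY at conductor `≤ 300000` (Cremona, by name)

Cell `bsd-addord`, seat `bsd-addord-w2-c4` (gen 5), item `stmt-BirchSwinnertonDyer-19599`. The crux's
second stub `stub_additiveDefect` covers the additive-`3` tower rows of the optimal datum `D₀` at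
`N = N_E` with `3 ∣ c₃` (Kodaira IV / IV*) OR `3 ∣ c_{D₀}` (the Manin constant of the optimal
parametrisation). The second disjunct never occurs on the cell's booked range: Cremona's completed
modular-symbol computation ("the Manin constant is `1` for every optimal curve of conductor
`≤ 300000`", `ecdata/manin.txt`; Agashe–Ribet–Stein 2006 Thm. 2.6 at `130000`; quoted in
Česnavičius–Neururer–Saha 2023 §1) is the tree's named fact
`cremona_abs_maninConstant_eq_one_of_level_le_300000` (statement only, HELD by name as `hCre`), in
exactly the lattice rendering `Λ_{E'} ⊆ c Λ_f` that the crux's optimality binder `hopt` uses. Hence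
(theorems only; nothing asserted; crux 19599 stays OPEN):

* `three_dvd_localTamagawaNumber_of_defect_of_level_le_300000` — on a row of `stub_additiveDefect` with
  `N ≤ 300000` the defect disjunction IS `3 ∣ c₃`;
* `shallowEqDeepOff_row_maninDefect_of_level_le_300000` — the crux's conclusion on the `3 ∣ c_{D₀}` branch
  at `N ≤ 300000`, VACUOUSLY (binders of `stub_additiveDefect` verbatim, then `N ≤ 300000` and the branch);
* `stub_additiveDefect_le_300000_of_tamagawaBranch` — at `N ≤ 300000` the stub REDUCES to its Kodaira
  IV / IV* branch `3 ∣ c₃` (which is wild at `3`: outside K1's locus `N10.Locus W 3`, so only the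
  `BSD_p`-free sockets §1 of `KimAtThreeShallowEqDeepOffStratumSockets` apply to it today).

Above `300000` nothing in print excludes `3 ∣ c_{D₀}` at an additive `3` (Mazur 1978 Cor. 4.1 needs
`9 ∤ N`; Edixhoven 1991 / ARS conjecture `c = 1` open); there the branch is a genuine population of the
crux and the sockets apply with every `∂`-currency quantity shifted by `v₃(c_{D₀})`.

References: [Cremona2022ManinConstants] manin.txt ¶2; [AgasheRibetStein2006] Thm. 2.6;
[CesnaviciusNeururerSaha2023] §1; [Mazur1978] Cor. 4.1; [Kim2025RefinedTNC] §8.1.2.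
-/

set_option autoImplicit false
-- the Theorems namespace of a single-conjunct summit repeats the summit name by design (D-0017)
set_option linter.dupNamespace false

noncomputable section

open scoped MatrixGroups ModularForm Classical

open CongruenceSubgroup WeierstrassCurve Literature.NumberTheory.EllipticCurves
  Literature.NumberTheory.EllipticCurves.ModularForms
  Literature.NumberTheory.EllipticCurves.Rank1Residual

namespace Summit.BirchSwinnertonDyer.BirchSwinnertonDyer.Theorems.KimAtThreeShallowEqDeepOffStratumManinDefect

/-- **On a row of `stub_additiveDefect` with `N ≤ 300000` the defect is `3 ∣ c₃`**: the optimal datum has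
`|c_{D₀}| = 1` by Cremona's fact (`hCre`), so the disjunct `3 ∣ c_{D₀}` is impossible.
[cite: Cremona2022ManinConstants, manin.txt ¶2] [cite: AgasheRibetStein2006, Thm. 2.6] -/
theorem three_dvd_localTamagawaNumber_of_defect_of_level_le_300000
    (hCre : cremona_abs_maninConstant_eq_one_of_level_le_300000)
    (W₀ : WeierstrassCurve ℚ) [W₀.IsElliptic] [W₀.IsGloballyMinimal] {N : ℕ} [NeZero N]
    (D₀ : ModularParametrizationData W₀ N)
    (hopt : ∀ z ∈ D₀.L.lattice, ∃ w ∈ periodLattice D₀.f, z = D₀.c * w) (hN : N ≤ 300000)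
    (hdef : 3 ∣ (W₀.baseChange ℚ_[3]).localTamagawaNumber ℤ_[3] ∨ (3 : ℤ) ∣ D₀.maninConstant) :
    3 ∣ (W₀.baseChange ℚ_[3]).localTamagawaNumber ℤ_[3] :=
  hdef.resolve_right (not_dvd_maninConstant_of_level_le_300000 hCre W₀ D₀ hopt hN Nat.prime_three)

/-- **Crux 19599 on the «`3 ∣ c_{D₀}`» branch at conductor `≤ 300000` — VACUOUSLY** (binders of
`stub_additiveDefect` verbatim up to the additive hypothesis, then the branch `3 ∣ c_{D₀}` and
`N ≤ 300000`; Cremona's fact `hCre` by name). [cite: Cremona2022ManinConstants, manin.txt ¶2]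
[cite: CesnaviciusNeururerSaha2023, §1] -/
theorem shallowEqDeepOff_row_maninDefect_of_level_le_300000
    (hCre : cremona_abs_maninConstant_eq_one_of_level_le_300000) :
    ∀ (W₀ : WeierstrassCurve ℚ) [W₀.IsElliptic] [W₀.IsGloballyMinimal],
      (∀ n : ℕ, W₀.HasSurjectiveModNGaloisRep (3 ^ n : ℕ)) →
      Nat.card {Q : (W₀.baseChange ℚ_[3]).toAffine.Point // (3 : ℕ) • Q = 0} = 1 → Finite W₀.sha →
      ∀ {N : ℕ} [NeZero N], N = W₀.conductorNorm ℤ → ∀ (D₀ : ModularParametrizationData W₀ N),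
        (∀ z ∈ D₀.L.lattice, ∃ w ∈ periodLattice D₀.f, z = D₀.c * w) →
        (∀ (W₂ : WeierstrassCurve ℚ) [W₂.IsElliptic] (D₂ : ModularParametrizationData W₂ N),
          D₂.f = D₀.f → D₀.modularDegree ≤ D₂.modularDegree) →
        (∀ r : ℚ, ratPlusSymbol D₀.f r ≠ 0 → 0 ≤ padicValRat 3 (ratPlusSymbol D₀.f r)) →
        kuriharaVanishingOrder W₀ 3 D₀.f = 0 →
        (haveI : Fact (Nat.Prime 3) := ⟨Nat.prime_three⟩; Addv W₀ 3) →
        (3 : ℤ) ∣ D₀.maninConstant → N ≤ 300000 →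
        kuriharaPartialDeepInfty W₀ 3 D₀.f ≤ kuriharaPartialInfty W₀ 3 D₀.f := by
  intro W₀ _ _ _ _ _ N _ _ D₀ hopt _ _ _ _ hc hN
  exact absurd hc (not_dvd_maninConstant_of_level_le_300000 hCre W₀ D₀ hopt hN Nat.prime_three)

/-- **At conductor `≤ 300000` the stub `stub_additiveDefect` REDUCES to its Kodaira IV / IV* branch**:
if the crux's conclusion holds on every additive-`3` row of the stub with `3 ∣ c₃` (and `N ≤ 300000`),
it holds on every row of the stub with `N ≤ 300000` (the `3 ∣ c_{D₀}` rows do not exist, Cremona `hCre`).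
[cite: Cremona2022ManinConstants, manin.txt ¶2] [cite: AgasheRibetStein2006, Thm. 2.6] -/
theorem stub_additiveDefect_le_300000_of_tamagawaBranch
    (hCre : cremona_abs_maninConstant_eq_one_of_level_le_300000)
    (h : ∀ (W₀ : WeierstrassCurve ℚ) [W₀.IsElliptic] [W₀.IsGloballyMinimal],
      (∀ n : ℕ, W₀.HasSurjectiveModNGaloisRep (3 ^ n : ℕ)) →
      Nat.card {Q : (W₀.baseChange ℚ_[3]).toAffine.Point // (3 : ℕ) • Q = 0} = 1 → Finite W₀.sha →
      ∀ {N : ℕ} [NeZero N], N = W₀.conductorNorm ℤ → ∀ (D₀ : ModularParametrizationData W₀ N),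
        (∀ z ∈ D₀.L.lattice, ∃ w ∈ periodLattice D₀.f, z = D₀.c * w) →
        (∀ (W₂ : WeierstrassCurve ℚ) [W₂.IsElliptic] (D₂ : ModularParametrizationData W₂ N),
          D₂.f = D₀.f → D₀.modularDegree ≤ D₂.modularDegree) →
        (∀ r : ℚ, ratPlusSymbol D₀.f r ≠ 0 → 0 ≤ padicValRat 3 (ratPlusSymbol D₀.f r)) →
        kuriharaVanishingOrder W₀ 3 D₀.f = 0 →
        (haveI : Fact (Nat.Prime 3) := ⟨Nat.prime_three⟩; Addv W₀ 3) →
        3 ∣ (W₀.baseChange ℚ_[3]).localTamagawaNumber ℤ_[3] → N ≤ 300000 →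
        kuriharaPartialDeepInfty W₀ 3 D₀.f ≤ kuriharaPartialInfty W₀ 3 D₀.f) :
    ∀ (W₀ : WeierstrassCurve ℚ) [W₀.IsElliptic] [W₀.IsGloballyMinimal],
      (∀ n : ℕ, W₀.HasSurjectiveModNGaloisRep (3 ^ n : ℕ)) →
      Nat.card {Q : (W₀.baseChange ℚ_[3]).toAffine.Point // (3 : ℕ) • Q = 0} = 1 → Finite W₀.sha →
      ∀ {N : ℕ} [NeZero N], N = W₀.conductorNorm ℤ → ∀ (D₀ : ModularParametrizationData W₀ N),
        (∀ z ∈ D₀.L.lattice, ∃ w ∈ periodLattice D₀.f, z = D₀.c * w) →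
        (∀ (W₂ : WeierstrassCurve ℚ) [W₂.IsElliptic] (D₂ : ModularParametrizationData W₂ N),
          D₂.f = D₀.f → D₀.modularDegree ≤ D₂.modularDegree) →
        (∀ r : ℚ, ratPlusSymbol D₀.f r ≠ 0 → 0 ≤ padicValRat 3 (ratPlusSymbol D₀.f r)) →
        kuriharaVanishingOrder W₀ 3 D₀.f = 0 →
        (haveI : Fact (Nat.Prime 3) := ⟨Nat.prime_three⟩; Addv W₀ 3) →
        (3 ∣ (W₀.baseChange ℚ_[3]).localTamagawaNumber ℤ_[3] ∨ (3 : ℤ) ∣ D₀.maninConstant) →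
        N ≤ 300000 →
        kuriharaPartialDeepInfty W₀ 3 D₀.f ≤ kuriharaPartialInfty W₀ 3 D₀.f := by
  intro W₀ _ _ htow ht hfin N _ hN D₀ hopt hdeg hint hord hA hdef hN3
  exact h W₀ htow ht hfin hN D₀ hopt hdeg hint hord hA
    (three_dvd_localTamagawaNumber_of_defect_of_level_le_300000 hCre W₀ D₀ hopt hN3 hdef) hN3

end Summit.BirchSwinnertonDyer.BirchSwinnertonDyer.Theorems.KimAtThreeShallowEqDeepOffStratumManinDefect

end
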